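import Literature.NumberTheory.Automorphic.LangSteinberg
import Literature.NumberTheory.Automorphic.ReductiveGLn
import Mathlib.LinearAlgebra.Projectivization.Cardinality
import HarnessLib

/-!
# Frobenius-semilinear automorphisms over `k̄`: a basis of fixed vectors (Lang's theorem for
# `GL_m`), the number of fixed vectors and the number of stable lines

Let `k` be a finite field with `q` elements, `K ⊇ k` algebraically closed, `F = qFrobenius k K`
(`x ↦ x^q`), and `Φ : W →ₛₗ[F] W` an **injective `F`-semilinear endomorphism** of a finite-dimensional
`K`-space `W`.  We prove the classical facts (Lang 1956, "Algebraic groups over finite fields",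
Cor. of Thm. 1; SGA 7 XXII §1; Katz, "p-adic properties of modular schemes" Prop. 4.1.1 —
"a unit-root `F`-crystal over `k̄` is trivial"):

* `exists_mul_frobGL_eq` — **Lang's theorem for `GL_m`**: every `A ∈ GL_m(K)` is `A = C · F(C)⁻¹`;
  deduced from the tree's `lang_map_surjective_holds` [cite: SpringerLAG1998, Thm. 4.4.17].
* `exists_basis_fixed` — `W` has a `K`-basis of `Φ`-fixed vectors.
* `map_eq_self_iff`, `fixedEquiv`, `natCard_fixed_eq_pow` — in such a basis the fixed vectors are
  exactly the vectors with coordinates in `k`; hence `#{w | Φ w = w} = q ^ dim W`, and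
  `exists_ne_zero_map_eq`: a nonzero fixed vector exists when `W ≠ 0`.
* `EigenLine`, `eigenLineOfProj_bijective`, `natCard_eigenLine_eq_sum` — the lines `K u` with
  `Φ u ∈ K u` are in bijection with `ℙ(k^{dim W})`, so there are `1 + q + ⋯ + q^{dim W - 1}` of them.

These are the linear-algebra inputs for counting Frobenius-invariant divisors in an invariant divisor
class of a function field over `k̄` (applied to `Φ = ` Frobenius acting on a Riemann–Roch space).

## References
* S. Lang, *Algebraic groups over finite fields*, Amer. J. Math. 78 (1956), Thm. 1 and Cor.
* T. A. Springer, *Linear Algebraic Groups* (2nd ed. 1998), Thm. 4.4.17. [cite: SpringerLAG1998, Thm. 4.4.17]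
* J.-P. Serre, *Algebraic Groups and Class Fields*, VI §1 no. 4 Prop. 3.

#harness_tags topic:LinearAlgebra/Semilinear, lang-theorem, frobenius, finite-field
-/

noncomputable section

open scoped MatrixGroups LinearAlgebra.Projectivization
open Module

namespace Literature.LinearAlgebra.Semilinear

open Literature.NumberTheory.Automorphic

universe u v w

variable {k : Type u} {K : Type v} [Field k] [Field K] [Algebra k K] [Finite k]

/-! ### Lang's theorem for `GL_m` itself -/

section LangGL

variable {m : Type*} [Fintype m] [DecidableEq m]

/-- `GL m K` is defined over `k` (it is `F`-stable: `F` is onto for `K` perfect). [folklore] -/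
theorem isDefinedOver_univ [IsAlgClosed K] : IsDefinedOver k (Set.univ : Set (GL m K)) := by
  refine isDefinedOver_of_subset_image_frobGL k fun x _ => ?_
  obtain ⟨g, hg⟩ := (glMapEquiv (n := m) (qFrobeniusEquiv k K)).surjective x
  exact ⟨g, Set.mem_univ _, by rw [← glMapEquiv_qFrobeniusEquiv_apply, hg]⟩

/-- **Lang's theorem for `GL_m`** (Lang 1956; Springer 4.4.17; Serre VI §1 Prop. 3), from the
tree's `lang_map_surjective_holds` (`G = GL m K` is Zariski-connected, `isZConnected_top`, and defined
over `k`): for every `A ∈ GL m K̄` there is `C ∈ GL m K̄` with `A · F(C) = C` (namely `C = g⁻¹` for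
`g⁻¹ F(g) = A`). [cite: SpringerLAG1998, Thm. 4.4.17] -/
theorem exists_mul_frobGL_eq [IsAlgClosed K] (A : GL m K) : ∃ C : GL m K, A * frobGL k K m C = C := by
  have h : ∀ ⦃G : Subgroup (GL m K)⦄, IsZConnected G → IsDefinedOver k (G : Set (GL m K)) →
      ∀ x ∈ G, ∃ g ∈ G, g⁻¹ * frobGL k K m g = x :=
    lang_map_surjective_holds (k := k) (K := K) (n := m)
  have hdef : IsDefinedOver k ((⊤ : Subgroup (GL m K)) : Set (GL m K)) := by
    rw [Subgroup.coe_top]; exact isDefinedOver_univ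
  obtain ⟨g, -, hg⟩ := h (isZConnected_top (k := K) (n := m)) hdef A (Subgroup.mem_top A)
  refine ⟨g⁻¹, ?_⟩
  rw [map_inv, ← hg]
  group

end LangGL

/-! ### Semilinear maps: the matrix, and a basis of fixed vectors -/

section Semilinear

variable [IsAlgClosed K]
variable {W : Type w} [AddCommGroup W] [Module K W] [FiniteDimensional K W]
variable (Φ : W →ₛₗ[qFrobenius k K] W)

/-- **A `q`-Frobenius-semilinear injection of a finite-dimensional `K̄`-vector space has a basis of
fixed vectors** (Lang's theorem for `GL_m`, `H¹(k, GL_m) = 0`; Serre, *Algebraic Groups and Class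
Fields*, VI §1 no. 4–6; Springer 4.4.17): in a basis `e`, `Φ(∑ cⱼ eⱼ) = ∑ (A σ(c))ᵢ eᵢ` with
`A ∈ GL_m(K̄)`; writing `A = F(C)⁻¹…` precisely `A = C F(C)⁻¹` (Lang), the columns of `C` are fixed by
`Φ` and form a basis. [cite: SpringerLAG1998, Thm. 4.4.17] -/
theorem exists_basis_fixed (hΦ : Function.Injective Φ) :
    ∃ b : Basis (Fin (finrank K W)) K W, ∀ i, Φ (b i) = b i := by
  classical
  set e : Basis (Fin (finrank K W)) K W := finBasis K W with he
  -- the matrix of `Φ` in the basis `e`: `Φ (e j) = ∑ i, A i j • e i`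
  set A : Matrix (Fin (finrank K W)) (Fin (finrank K W)) K := fun i j => e.repr (Φ (e j)) i with hA
  have hΦe : ∀ j, Φ (e j) = ∑ i, A i j • e i := fun j => by
    conv_lhs => rw [← e.sum_repr (Φ (e j))]
  have hΦv : ∀ c : Fin (finrank K W) → K,
      Φ (∑ j, c j • e j) = ∑ i, (A.mulVec (qFrobenius k K ∘ c)) i • e i := by
    intro c
    rw [map_sum]
    simp_rw [LinearMap.map_smulₛₗ, hΦe, Finset.smul_sum, smul_smul]
    rw [Finset.sum_comm]
    refine Finset.sum_congr rfl fun i _ => ?_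
    rw [← Finset.sum_smul]
    congr 1
    simp [Matrix.mulVec, dotProduct, Function.comp_apply, mul_comm]
  -- `A` is invertible: `Φ` injective and `σ` onto
  have hσbij := qFrobenius_bijective k K
  have hAdet : IsUnit A.det := by
    rw [isUnit_iff_ne_zero, Ne, ← Matrix.exists_mulVec_eq_zero_iff]
    rintro ⟨v, hv0, hv⟩
    obtain ⟨c, hc⟩ : ∃ c : Fin (finrank K W) → K, qFrobenius k K ∘ c = v :=
      ⟨fun i => Function.surjInv hσbij.2 (v i), funext fun i => Function.surjInv_eq hσbij.2 (v i)⟩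
    have h1 : Φ (∑ j, c j • e j) = 0 := by rw [hΦv, hc, hv]; simp
    have h2 : ∑ j, c j • e j = 0 := hΦ (by rw [h1, map_zero])
    have h3 : ∀ j, c j = 0 := by
      have := e.linearIndependent
      rw [Fintype.linearIndependent_iff] at this
      exact this c h2
    apply hv0
    rw [← hc]; ext i; simp [h3 i, map_zero]
  set Au : GL (Fin (finrank K W)) K := Matrix.GeneralLinearGroup.mk'' A hAdet with hAu
  -- Lang: `A F(C) = C`
  obtain ⟨C, hC⟩ := exists_mul_frobGL_eq (k := k) (K := K) Au
  have hAC : A * ((frobGL k K _ C : GL _ K) : Matrix (Fin (finrank K W)) (Fin (finrank K W)) K) =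
      ((C : GL _ K) : Matrix (Fin (finrank K W)) (Fin (finrank K W)) K) := by
    have h1 := congrArg (fun x : GL (Fin (finrank K W)) K => (x : Matrix (Fin (finrank K W)) (Fin (finrank K W)) K)) hC
    simpa [Matrix.GeneralLinearGroup.coe_mul, hAu] using h1
  -- the new basis: columns of `C`
  have hCdet : IsUnit ((C : GL _ K) : Matrix (Fin (finrank K W)) (Fin (finrank K W)) K).det :=
    Matrix.isUnits_det_units C
  set b : Basis (Fin (finrank K W)) K W :=
    e.map (Matrix.toLinearEquiv e ((C : GL _ K) : Matrix (Fin (finrank K W)) (Fin (finrank K W)) K) hCdet) with hb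
  refine ⟨b, fun j => ?_⟩
  have hbj : b j = ∑ i, ((C : GL _ K) : Matrix (Fin (finrank K W)) (Fin (finrank K W)) K) i j • e i := by
    rw [hb, Basis.map_apply, Matrix.toLinearEquiv_apply, Matrix.toLin_self]
  rw [hbj, hΦv]
  refine Finset.sum_congr rfl fun i _ => ?_
  congr 1
  -- `(A · σ(C_{·j}))ᵢ = (A F(C))ᵢⱼ = Cᵢⱼ`
  have := congrFun (congrFun hAC i) j
  rw [Matrix.mul_apply] at this
  rw [← this, Matrix.mulVec, dotProduct]
  refine Finset.sum_congr rfl fun l _ => ?_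
  rw [Function.comp_apply, frobGL_apply_apply, qFrobenius_apply]

/-! ### Coordinates in a basis of fixed vectors -/

section FixedBasis

variable {m : Type*} [Fintype m] {b : Basis m K W}

omit [IsAlgClosed K] [FiniteDimensional K W] in
/-- In a basis of fixed vectors, `Φ` is the `q`-Frobenius on coordinates. [folklore] -/
theorem repr_map_eq (hb : ∀ i, Φ (b i) = b i) (w : W) (i : m) :
    b.repr (Φ w) i = qFrobenius k K (b.repr w i) := by
  classical
  have hw : Φ w = ∑ j, qFrobenius k K (b.repr w j) • b j := by
    conv_lhs => rw [← b.sum_repr w, map_sum]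
    simp_rw [LinearMap.map_smulₛₗ, hb]
  rw [hw, b.repr_sum_self]

omit [IsAlgClosed K] [FiniteDimensional K W] in
/-- **Fixed vectors are the vectors with coordinates in `k`** (in a basis of fixed vectors).
[folklore] -/
theorem map_eq_self_iff (hb : ∀ i, Φ (b i) = b i) (w : W) :
    Φ w = w ↔ ∀ i, b.repr w i ∈ Set.range (algebraMap k K) := by
  rw [← b.repr.injective.eq_iff, Finsupp.ext_iff]
  refine forall_congr' fun i => ?_
  rw [repr_map_eq Φ hb, qFrobenius_eq_self_iff]

/-- The vector with coordinates `c ∈ k^m`: `∑ cᵢ bᵢ`. [folklore] -/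
def ofCoords (b : Basis m K W) (c : m → k) : W := ∑ i, algebraMap k K (c i) • b i

omit [Finite k] [IsAlgClosed K] [FiniteDimensional K W] in
/-- Its coordinates. [folklore] -/
theorem repr_ofCoords (c : m → k) (i : m) : b.repr (ofCoords b c) i = algebraMap k K (c i) := by
  classical
  rw [ofCoords, b.repr_sum_self]

omit [IsAlgClosed K] [FiniteDimensional K W] in
/-- `∑ cᵢ bᵢ` is fixed. [folklore] -/
theorem map_ofCoords (hb : ∀ i, Φ (b i) = b i) (c : m → k) : Φ (ofCoords b c) = ofCoords b c :=
  (map_eq_self_iff Φ hb _).2 fun i => ⟨c i, (repr_ofCoords c i).symm⟩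

omit [Finite k] [IsAlgClosed K] [FiniteDimensional K W] in
/-- `c ↦ ∑ cᵢ bᵢ` is injective. [folklore] -/
theorem ofCoords_injective : Function.Injective (ofCoords (k := k) b) := by
  intro c c' h
  funext i
  have := congrArg (fun w => b.repr w i) h
  simp only [repr_ofCoords] at this
  exact (algebraMap k K).injective this

omit [Finite k] [IsAlgClosed K] [FiniteDimensional K W] in
/-- `∑ cᵢ bᵢ = 0 ↔ c = 0`. [folklore] -/
theorem ofCoords_eq_zero_iff (c : m → k) : ofCoords b c = 0 ↔ c = 0 := by
  constructor
  · intro h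
    have h0 : ofCoords b (0 : m → k) = 0 := by simp [ofCoords]
    exact ofCoords_injective (h.trans h0.symm)
  · rintro rfl; simp [ofCoords]

omit [Finite k] [IsAlgClosed K] [FiniteDimensional K W] in
/-- Scalars: `∑ (a cᵢ) bᵢ = a • ∑ cᵢ bᵢ`. [folklore] -/
theorem ofCoords_smul (a : k) (c : m → k) : ofCoords b (a • c) = algebraMap k K a • ofCoords b c := by
  simp [ofCoords, Finset.smul_sum, smul_smul, map_mul]

omit [IsAlgClosed K] [FiniteDimensional K W] in
/-- Every fixed vector is `∑ cᵢ bᵢ` for a unique `c ∈ k^m`. [folklore] -/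
theorem exists_ofCoords_eq_of_map_eq (hb : ∀ i, Φ (b i) = b i) {w : W} (hw : Φ w = w) :
    ∃ c : m → k, ofCoords b c = w := by
  have h := (map_eq_self_iff Φ hb w).1 hw
  choose c hc using h
  refine ⟨c, b.repr.injective (Finsupp.ext fun i => ?_)⟩
  rw [repr_ofCoords, hc]

/-- **The fixed vectors are in bijection with `k^m`.** [folklore] -/
def fixedEquiv (hb : ∀ i, Φ (b i) = b i) : (m → k) ≃ {w : W // Φ w = w} :=
  Equiv.ofBijective (fun c => ⟨ofCoords b c, map_ofCoords Φ hb c⟩)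
    ⟨fun c c' h => ofCoords_injective (congrArg Subtype.val h),
     fun w => by obtain ⟨c, hc⟩ := exists_ofCoords_eq_of_map_eq Φ hb w.2; exact ⟨c, Subtype.ext hc⟩⟩

omit [IsAlgClosed K] [FiniteDimensional K W] in
/-- **`#{w : Φ w = w} = q^m`.** [folklore] -/
theorem natCard_fixed (hb : ∀ i, Φ (b i) = b i) : Nat.card {w : W // Φ w = w} = Nat.card k ^ Fintype.card m := by
  rw [← Nat.card_congr (fixedEquiv Φ hb), Nat.card_fun, Nat.card_eq_fintype_card (α := m)]

omit [IsAlgClosed K] [FiniteDimensional K W] in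
/-- Two nonzero fixed vectors spanning the same `K̄`-line differ by a scalar in `kˣ`: if
`w' = a • w` with `w, w'` fixed and `w ≠ 0` then `a ∈ k`. [folklore] -/
theorem mem_range_of_smul_fixed {w : W} (hw : Φ w = w) (hw0 : w ≠ 0) {a : K}
    (hw' : Φ (a • w) = a • w) : a ∈ Set.range (algebraMap k K) := by
  rw [LinearMap.map_smulₛₗ, hw] at hw'
  have : (qFrobenius k K a - a) • w = 0 := by rw [sub_smul, hw', sub_self]
  rw [smul_eq_zero, sub_eq_zero] at this
  exact (qFrobenius_eq_self_iff k).1 (this.resolve_right hw0)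

omit [FiniteDimensional K W] in
/-- An eigenline of an injective semilinear map contains a nonzero fixed vector: if `Φ u = c u`,
`u ≠ 0`, then `c ≠ 0` and for `μ` with `μ^{q-1} = c⁻¹` (which exists in `K̄`), `Φ (μ u) = μ u`.
[folklore] -/
theorem exists_smul_fixed_of_eigen (hΦ : Function.Injective Φ) {u : W} (hu : u ≠ 0) {c : K}
    (hc : Φ u = c • u) : ∃ μ : K, μ ≠ 0 ∧ Φ (μ • u) = μ • u := by
  letI := Fintype.ofFinite k
  have hc0 : c ≠ 0 := by
    rintro rfl
    rw [zero_smul, ← map_zero Φ] at hc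
    exact hu (hΦ hc)
  -- `μ` a root of `X^(q-1) - c⁻¹`
  have hq : 1 < Nat.card k := Finite.one_lt_card
  set P : Polynomial K := Polynomial.X ^ (Nat.card k - 1) - Polynomial.C c⁻¹ with hP
  have hdeg : P.degree ≠ 0 := by
    rw [hP, Polynomial.degree_X_pow_sub_C (by omega)]
    exact_mod_cast (show Nat.card k - 1 ≠ 0 by omega)
  obtain ⟨μ, hμ⟩ := IsAlgClosed.exists_root P hdeg
  rw [Polynomial.IsRoot.def, hP, Polynomial.eval_sub, Polynomial.eval_pow, Polynomial.eval_X,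
    Polynomial.eval_C, sub_eq_zero] at hμ
  have hμ0 : μ ≠ 0 := by
    rintro rfl
    rw [zero_pow (by omega)] at hμ
    exact inv_ne_zero hc0 hμ.symm
  refine ⟨μ, hμ0, ?_⟩
  rw [LinearMap.map_smulₛₗ, hc, smul_smul, qFrobenius_apply]
  congr 1
  calc μ ^ Nat.card k * c = μ * (μ ^ (Nat.card k - 1) * c) := by
        rw [← mul_assoc, ← pow_succ']; congr 2; omega
    _ = μ := by rw [hμ, inv_mul_cancel₀ hc0, mul_one]

/-! ### Counting the `Φ`-stable lines -/

/-- The `K̄`-lines spanned by an eigenvector of `Φ` (`Φ u = c u`, `u ≠ 0`) — for `Φ` injective these are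
exactly the `Φ`-stable lines. [folklore] -/
abbrev EigenLine : Type w :=
  {L : Submodule K W // ∃ u : W, u ≠ 0 ∧ (∃ c : K, Φ u = c • u) ∧ L = K ∙ u}

/-- From `ℙ(k^m)` to the eigenlines: `[c] ↦ K̄ · ∑ cᵢ bᵢ`. [folklore] -/
def eigenLineOfProj (hb : ∀ i, Φ (b i) = b i) : ℙ k (m → k) → EigenLine Φ :=
  Projectivization.lift
    (fun c => (⟨K ∙ ofCoords b c.1, ofCoords b c.1, by rw [Ne, ofCoords_eq_zero_iff]; exact c.2,
      ⟨1, by rw [one_smul, map_ofCoords Φ hb]⟩, rfl⟩ : EigenLine Φ))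
    (by
      rintro ⟨c, hc⟩ ⟨c', hc'⟩ t h
      apply Subtype.ext
      have h' : c = t • c' := by simpa using h
      have ht : t ≠ 0 := by rintro rfl; exact hc (by rw [h', zero_smul])
      show (K ∙ ofCoords b c) = K ∙ ofCoords b c'
      rw [h', ofCoords_smul]
      exact Submodule.span_singleton_smul_eq ((IsUnit.mk0 t ht).map (algebraMap k K)) _)

omit [FiniteDimensional K W] in
/-- **The eigenlines are in bijection with `ℙ(k^m)`.** [folklore] -/
theorem eigenLineOfProj_bijective (hΦ : Function.Injective Φ) (hb : ∀ i, Φ (b i) = b i) :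
    Function.Bijective (eigenLineOfProj Φ hb) := by
  constructor
  · intro x y hxy
    induction x using Projectivization.ind with
    | h c hc =>
    induction y using Projectivization.ind with
    | h c' hc' =>
    simp only [eigenLineOfProj, Projectivization.lift_mk, Subtype.mk.injEq] at hxy
    rw [Submodule.span_singleton_eq_span_singleton] at hxy
    obtain ⟨z, hz⟩ := hxy
    -- `z` is fixed-proportionality, hence in `k`
    have hzk : (z : K) ∈ Set.range (algebraMap k K) := by
      refine mem_range_of_smul_fixed Φ (map_ofCoords Φ hb c) (by rw [Ne, ofCoords_eq_zero_iff]; exact hc) ?_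
      rw [show (z : K) • ofCoords b c = ofCoords b c' from hz]
      exact map_ofCoords Φ hb c'
    obtain ⟨a, ha⟩ := hzk
    have ha0 : a ≠ 0 := by rintro rfl; rw [map_zero] at ha; exact z.ne_zero ha.symm
    rw [Projectivization.mk_eq_mk_iff]
    refine ⟨(Units.mk0 a ha0)⁻¹, ofCoords_injective (b := b) ?_⟩
    rw [Units.smul_def, ofCoords_smul, Units.val_inv_eq_inv_val, Units.val_mk0, map_inv₀, ha, ← hz,
      Units.smul_def, smul_smul, inv_mul_cancel₀ z.ne_zero, one_smul]
  · rintro ⟨L, u, hu, ⟨c, hc⟩, rfl⟩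
    obtain ⟨μ, hμ0, hμ⟩ := exists_smul_fixed_of_eigen Φ hΦ hu hc
    obtain ⟨c₀, hc₀⟩ := exists_ofCoords_eq_of_map_eq Φ hb hμ
    have hc₀0 : c₀ ≠ 0 := by
      rintro rfl
      rw [(ofCoords_eq_zero_iff (b := b) 0).2 rfl] at hc₀
      exact (smul_ne_zero hμ0 hu) hc₀.symm
    refine ⟨Projectivization.mk k c₀ hc₀0, Subtype.ext ?_⟩
    show (K ∙ ofCoords b c₀) = K ∙ u
    rw [hc₀]
    exact Submodule.span_singleton_smul_eq (IsUnit.mk0 μ hμ0) u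

omit [FiniteDimensional K W] in
/-- **The number of `Φ`-stable lines is `#ℙ^{m-1}(k) = 1 + q + ⋯ + q^{m-1}`** (`m = dim W`), for an
injective `q`-Frobenius-semilinear map with a basis of fixed vectors. [folklore] -/
theorem natCard_eigenLine (hΦ : Function.Injective Φ) (hb : ∀ i, Φ (b i) = b i) :
    Nat.card (EigenLine Φ) = ∑ i ∈ Finset.range (Fintype.card m), Nat.card k ^ i := by
  letI := Fintype.ofFinite k
  rw [← Nat.card_congr (Equiv.ofBijective _ (eigenLineOfProj_bijective Φ hΦ hb)),
    Projectivization.card_of_finrank k (m → k) (Module.finrank_fintype_fun_eq_card k)]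

end FixedBasis

/-! ### Unconditional forms (Lang's theorem supplies the basis) -/

section Main

/-- **Fixed vectors of an injective `q`-Frobenius-semilinear map**: `#{w : Φ w = w} = q^{dim W}`.
[folklore] -/
theorem natCard_fixed_eq_pow (hΦ : Function.Injective Φ) :
    Nat.card {w : W // Φ w = w} = Nat.card k ^ finrank K W := by
  obtain ⟨b, hb⟩ := exists_basis_fixed Φ hΦ
  rw [natCard_fixed Φ hb, Fintype.card_fin]

/-- **A nonzero fixed vector exists** when `W ≠ 0`. [folklore] -/
theorem exists_ne_zero_map_eq (hΦ : Function.Injective Φ) (hW : 0 < finrank K W) :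
    ∃ w : W, w ≠ 0 ∧ Φ w = w := by
  obtain ⟨b, hb⟩ := exists_basis_fixed Φ hΦ
  exact ⟨b ⟨0, hW⟩, b.ne_zero _, hb _⟩

/-- **The number of `Φ`-stable lines is `1 + q + ⋯ + q^{dim W - 1}`.** [folklore] -/
theorem natCard_eigenLine_eq_sum (hΦ : Function.Injective Φ) :
    Nat.card (EigenLine Φ) = ∑ i ∈ Finset.range (finrank K W), Nat.card k ^ i := by
  obtain ⟨b, hb⟩ := exists_basis_fixed Φ hΦ
  rw [natCard_eigenLine Φ hΦ hb, Fintype.card_fin]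

/-- Fraction-free: `(q - 1) · #lines = q^{dim W} - 1`. [folklore] -/
theorem sub_one_mul_natCard_eigenLine (hΦ : Function.Injective Φ) :
    ((Nat.card k : ℤ) - 1) * Nat.card (EigenLine Φ) = (Nat.card k : ℤ) ^ finrank K W - 1 := by
  rw [natCard_eigenLine_eq_sum Φ hΦ]
  push_cast
  rw [mul_comm, geom_sum_mul]

end Main

end Semilinear

end Literature.LinearAlgebra.Semilinear

end
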